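import Mathlib
import HarnessLib

/-!
# Exponential sums over multiplicative subgroups of `(ℤ/mℤ)ˣ`: the square-root bound

* S. V. Konyagin, I. E. Shparlinski, *Character Sums with Exponential Functions and their
  Applications*, Cambridge Tracts in Mathematics 136, CUP (1999), Chapter 3, Theorem 3.4,
  bound (3.15): for any integer ideal `𝔮` relatively prime to each generator `λ₁, …, λ_r` of the
  finitely generated multiplicative group `V`, `S(𝔮, V) ≤ Nm(𝔮)^{1/2}`, where (opening of
  Chapter 3) `S(𝔮, V) = max_{α ∈ Λ_𝔮^*} |∑_{v ∈ V_𝔮} χ(α v)|`, `Λ_𝔮` is the residue ring, `Λ_𝔮^*`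
  its group of units, `V_𝔮 ≤ Λ_𝔮^*` the reduction of `V`, `χ` a primitive additive character of
  `Λ_𝔮`. Proof there: Lemma 3.1 (i) with `k = 1` and `T₁(𝔮, V) = |V_𝔮|` (3.1).

We state the case `𝕂 = ℚ` (`Λ_𝔮 = ℤ/mℤ`, `Nm(𝔮) = m`, `χ = e_m`; the book's own restatement "for
the field of rational numbers" in Chapter 3) for an arbitrary subgroup `H ≤ (ℤ/mℤ)ˣ` — every such
`H` is the reduction `V_m` of a finitely generated `V ≤ ℚ^*` with generators prime to `m`, and
conversely, so this is exactly the printed range of (3.15). The additive character is Mathlib's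
`ZMod.stdAddChar : AddChar (ZMod m) ℂ`, `j ↦ exp (2πi j/m)` (primitive:
`ZMod.isPrimitive_stdAddChar`).

The named fact `subgroupExpSum_norm_le_sqrt` is DISCHARGED in this file
(`subgroupExpSum_norm_le_sqrt_holds`) by the Parseval argument behind Lemma 3.1 (i), `k = 1`:
`a ↦ ∑_{v ∈ H} e_m(a v)` is invariant under `a ↦ a h` (`h ∈ H`), so
`|H| · |∑_{v ∈ H} e_m(α v)|² ≤ ∑_{a ∈ ℤ/m} |∑_{v ∈ H} e_m(a v)|² = m · |H|` (orthogonality of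
`e_m`, `AddChar.sum_mulShift`). The one-generator corollary `cyclicExpSum_norm_le_sqrt`
(`V = ⟨a⟩`, sum over `j < ord_m a`) is the shape consumed by route
`Summit.QuantumAdvantage.QuantumAdvantage.Theses.ShorLocallyDark` (items
`WorkDigitsEquidistributed`, `MixedMarginalsDark`): digits of the subgroup `⟨a⟩ ⊂ (ℤ/pq)ˣ` are
controlled by `max_{ξ unit} |∑_{ℓ < r} e_N(ξ a^ℓ)| ≤ √N` and, at the non-unit frequencies
`ξ ∈ pℤ`, by the same bound modulo `q`.
-/

namespace Literature.NumberTheory.GaussSums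

open scoped BigOperators ComplexConjugate

open Classical in
/-- **Konyagin–Shparlinski, Theorem 3.4, bound (3.15)** (case `𝕂 = ℚ`): for every modulus
`m ≥ 1`, every subgroup `H` of `(ℤ/mℤ)ˣ` and every unit `α`, `|∑_{v ∈ H} e_m(α v)| ≤ m^{1/2}`.
Discharged below (`subgroupExpSum_norm_le_sqrt_holds`).
[cite: KonyaginShparlinski1999, Thm 3.4 (3.15)] -/
def subgroupExpSum_norm_le_sqrt : Prop :=
  ∀ (m : ℕ) [NeZero m] (H : Subgroup (ZMod m)ˣ) (α : (ZMod m)ˣ),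
    ‖∑ v ∈ (Finset.univ.filter fun v : (ZMod m)ˣ => v ∈ H),
        ZMod.stdAddChar ((α : ZMod m) * (v : ZMod m))‖ ≤ Real.sqrt m

/-- The sum `∑_{v ∈ H} ψ(a v)` is invariant under `a ↦ a h` for `h ∈ H` (reindex `v ↦ h v`).
[cite: KonyaginShparlinski1999, Thm 3.4 (3.15)] -/
theorem sum_stdAddChar_subgroup_mul_mem {m : ℕ} [NeZero m] (H : Subgroup (ZMod m)ˣ)
    [DecidablePred (· ∈ H)] {h : (ZMod m)ˣ} (hh : h ∈ H) (a : ZMod m) :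
    ∑ v ∈ (Finset.univ.filter fun v : (ZMod m)ˣ => v ∈ H),
        ZMod.stdAddChar (a * (h : ZMod m) * (v : ZMod m)) =
      ∑ v ∈ (Finset.univ.filter fun v : (ZMod m)ˣ => v ∈ H),
        ZMod.stdAddChar (a * (v : ZMod m)) := by
  refine Finset.sum_nbij (fun v => h * v) ?_ ?_ ?_ ?_
  · intro v hv
    simp only [Finset.mem_univ, true_and, Finset.mem_filter] at hv ⊢
    exact H.mul_mem hh hv
  · intro v _ w _ hvw
    exact mul_left_cancel hvw
  · intro w hw
    simp only [Finset.coe_filter, Finset.mem_univ, true_and, Set.mem_setOf_eq] at hw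
    refine ⟨h⁻¹ * w, ?_, by simp⟩
    simp only [Finset.coe_filter, Finset.mem_univ, true_and, Set.mem_setOf_eq]
    exact H.mul_mem (H.inv_mem hh) hw
  · intro v _
    simp [mul_assoc]

/-- **Parseval for subgroup sums**: `∑_{a ∈ ℤ/m} |∑_{v ∈ H} e_m(a v)|² = m · |H|`
(orthogonality of the primitive character `e_m`). [cite: KonyaginShparlinski1999, Thm 3.4 (3.15)] -/
theorem sum_norm_sq_sum_stdAddChar_subgroup {m : ℕ} [NeZero m] (H : Subgroup (ZMod m)ˣ)
    [DecidablePred (· ∈ H)] :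
    ∑ a : ZMod m, ‖∑ v ∈ (Finset.univ.filter fun v : (ZMod m)ˣ => v ∈ H),
        ZMod.stdAddChar (a * (v : ZMod m))‖ ^ 2 =
      (m : ℝ) * (Finset.univ.filter fun v : (ZMod m)ˣ => v ∈ H).card := by
  classical
  set HF : Finset (ZMod m)ˣ := Finset.univ.filter fun v : (ZMod m)ˣ => v ∈ H with hHF
  set ψ : AddChar (ZMod m) ℂ := ZMod.stdAddChar with hψ
  have hchar : 0 < ringChar (ZMod m) := by
    rw [ZMod.ringChar_zmod_n]
    exact Nat.pos_of_ne_zero (NeZero.ne m)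
  -- the identity in `ℂ`
  have hC : ∀ a : ZMod m, ((‖∑ v ∈ HF, ψ (a * (v : ZMod m))‖ ^ 2 : ℝ) : ℂ) =
      ∑ v ∈ HF, ∑ w ∈ HF, ψ (a * ((w : ZMod m) - (v : ZMod m))) := by
    intro a
    rw [← Complex.normSq_eq_norm_sq, Complex.normSq_eq_conj_mul_self, map_sum, Finset.sum_mul]
    refine Finset.sum_congr rfl fun v _ => ?_
    rw [Finset.mul_sum]
    refine Finset.sum_congr rfl fun w _ => ?_
    rw [AddChar.starComp_apply hchar, AddChar.inv_apply, ← AddChar.map_add_eq_mul]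
    congr 1
    ring
  have hsum : (∑ a : ZMod m, ((‖∑ v ∈ HF, ψ (a * (v : ZMod m))‖ ^ 2 : ℝ) : ℂ)) =
      (m : ℂ) * (HF.card : ℂ) := by
    simp_rw [hC]
    rw [Finset.sum_comm]
    have inner : ∀ v ∈ HF, (∑ a : ZMod m, ∑ w ∈ HF, ψ (a * ((w : ZMod m) - (v : ZMod m)))) =
        (m : ℂ) := by
      intro v hv
      rw [Finset.sum_comm]
      have : ∀ w ∈ HF, (∑ a : ZMod m, ψ (a * ((w : ZMod m) - (v : ZMod m)))) =
          if w = v then (m : ℂ) else 0 := by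
        intro w _
        rw [AddChar.sum_mulShift _ (ZMod.isPrimitive_stdAddChar m), ZMod.card]
        by_cases hwv : w = v
        · simp [hwv]
        · have : (w : ZMod m) - (v : ZMod m) ≠ 0 := by
            rw [sub_ne_zero]
            exact fun h => hwv (Units.val_injective h)
          simp [hwv, this]
      rw [Finset.sum_congr rfl this, Finset.sum_ite_eq' HF v, if_pos hv]
    rw [Finset.sum_congr rfl inner, Finset.sum_const, nsmul_eq_mul, mul_comm]
  exact_mod_cast hsum

/-- **Discharge of `subgroupExpSum_norm_le_sqrt`** (Konyagin–Shparlinski (3.15), `𝕂 = ℚ`):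
`|H| · |S(α)|² = ∑_{h ∈ H} |S(α h)|² ≤ ∑_{a} |S(a)|² = m · |H|`.
[cite: KonyaginShparlinski1999, Thm 3.4 (3.15)] -/
theorem subgroupExpSum_norm_le_sqrt_holds : subgroupExpSum_norm_le_sqrt := by
  intro m _ H α
  classical
  -- reduce to the statement with the `classical` decidability instance
  suffices key : ∀ [DecidablePred (· ∈ H)],
      ‖∑ v ∈ (Finset.univ.filter fun v : (ZMod m)ˣ => v ∈ H),
        ZMod.stdAddChar ((α : ZMod m) * (v : ZMod m))‖ ≤ Real.sqrt m by
    convert key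
  intro _
  set HF : Finset (ZMod m)ˣ := Finset.univ.filter fun v : (ZMod m)ˣ => v ∈ H with hHF
  set S : ZMod m → ℝ := fun a =>
    ‖∑ v ∈ HF, ZMod.stdAddChar (a * (v : ZMod m))‖ with hS
  have hHFmem : ∀ v : (ZMod m)ˣ, v ∈ HF ↔ v ∈ H := fun v => by simp [hHF]
  have hne : HF.Nonempty := ⟨1, (hHFmem 1).2 H.one_mem⟩
  have hcard : (0 : ℝ) < HF.card := by exact_mod_cast hne.card_pos
  -- invariance: S (α h) = S α for h ∈ H
  have hinv : ∀ h ∈ HF, S ((α : ZMod m) * (h : ZMod m)) = S α := by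
    intro h hh
    simp only [hS]
    rw [sum_stdAddChar_subgroup_mul_mem H ((hHFmem h).1 hh)]
  -- |H| S(α)^2 ≤ ∑_a S(a)^2 = m |H|
  have h1 : (HF.card : ℝ) * S α ^ 2 = ∑ h ∈ HF, S ((α : ZMod m) * (h : ZMod m)) ^ 2 := by
    rw [Finset.sum_congr rfl fun h hh => by rw [hinv h hh], Finset.sum_const, nsmul_eq_mul]
  have h2 : ∑ h ∈ HF, S ((α : ZMod m) * (h : ZMod m)) ^ 2 ≤ ∑ a : ZMod m, S a ^ 2 := by
    have hinj : Set.InjOn (fun h : (ZMod m)ˣ => (α : ZMod m) * (h : ZMod m)) (HF : Set (ZMod m)ˣ) := by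
      intro h _ h' _ hhh
      have : ((α * h : (ZMod m)ˣ) : ZMod m) = ((α * h' : (ZMod m)ˣ) : ZMod m) := by
        simpa [Units.val_mul] using hhh
      exact mul_left_cancel (Units.val_injective this)
    rw [← Finset.sum_image (f := fun a => S a ^ 2) hinj]
    exact Finset.sum_le_univ_sum_of_nonneg fun a => sq_nonneg (S a)
  have h3 : ∑ a : ZMod m, S a ^ 2 = (m : ℝ) * HF.card := by
    simp only [hS]
    exact sum_norm_sq_sum_stdAddChar_subgroup H
  have h4 : S α ^ 2 ≤ m := by
    have : (HF.card : ℝ) * S α ^ 2 ≤ (HF.card : ℝ) * m := by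
      rw [h1, mul_comm (HF.card : ℝ)]
      exact h2.trans (le_of_eq h3)
    exact le_of_mul_le_mul_left this hcard
  have h5 : S α ≤ Real.sqrt m := Real.le_sqrt_of_sq_le h4
  simpa [hS] using h5

/-- **Konyagin–Shparlinski, Theorem 3.4, (3.15)**, one generator (`r = 1`, `V = ⟨a⟩`, `𝕂 = ℚ`):
for `m ≥ 1`, `a` a unit mod `m` of multiplicative order `t = ord_m(a)` and `α` a unit,
`|∑_{j=0}^{t-1} e_m(α a^j)| ≤ m^{1/2}` — the sum runs once over `V_m = {1, a, …, a^{t-1}}`.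
Corollary of `subgroupExpSum_norm_le_sqrt_holds` with `H = ⟨a⟩`. Grounds the exponential-sum
engine of `Summit.QuantumAdvantage.QuantumAdvantage.Theses.ShorLocallyDark.WorkDigitsEquidistributed`.
[cite: KonyaginShparlinski1999, Thm 3.4 (3.15)] -/
theorem cyclicExpSum_norm_le_sqrt (m : ℕ) [NeZero m] {a α : ZMod m} (ha : IsUnit a)
    (hα : IsUnit α) :
    ‖∑ j ∈ Finset.range (orderOf a), ZMod.stdAddChar (α * a ^ j)‖ ≤ Real.sqrt m := by
  classical
  obtain ⟨u, rfl⟩ := ha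
  obtain ⟨β, rfl⟩ := hα
  have key := subgroupExpSum_norm_le_sqrt_holds m (Subgroup.zpowers u) β
  have hset : (Finset.univ.filter fun v : (ZMod m)ˣ => v ∈ Subgroup.zpowers u) =
      (Finset.range (orderOf u)).image (u ^ ·) := by
    ext v
    simp only [Finset.mem_filter, Finset.mem_univ, true_and]
    exact (isOfFinOrder_of_finite u).mem_zpowers_iff_mem_range_orderOf
  have hinj : Set.InjOn (u ^ ·) (Finset.range (orderOf u) : Set ℕ) := by
    intro i hi j hj hij
    exact pow_injOn_Iio_orderOf (by simpa using hi) (by simpa using hj) hij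
  have key' : ‖∑ v ∈ (Finset.univ.filter fun v : (ZMod m)ˣ => v ∈ Subgroup.zpowers u),
      ZMod.stdAddChar ((β : ZMod m) * (v : ZMod m))‖ ≤ Real.sqrt m := by
    convert key
  rw [hset, Finset.sum_image hinj] at key'
  simpa [orderOf_units, Units.val_pow_eq_pow_val] using key'

end Literature.NumberTheory.GaussSums
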